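import Literature.Geometry.Symplectic.TwoChartSphereInversion
import Literature.Geometry.Symplectic.JHolomorphicMap
import Mathlib.Geometry.Manifold.MFDeriv.SpecificFunctions

/-!
# Zero sets of two-chart functions on the Riemann sphere: all or finitely many; the second chart is immersed
(registered helper `helper_twoChartZeroSetUnivOrFinite` of line `cross-cap-laurent`, crux `GromovRecognitionRelEnd`,
item stmt-SmoothPoincare4-11009; topological input of the assembly of the child stub
`stub_normalVelocityDichotomy` of the split piece `LocalFoliationEmbeddedSpheres`, item
stmt-SmoothPoincare4-16778)

Two elementary facts about objects on the sphere `S² = ℂ ∪ {∞}` given through the two affine charts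
`z` and `w = 1/z`.

* `helper_twoChartZeroSetUnivOrFinite` — a function on the sphere given by its chart readings
  `h₀, h₁ : ℂ → ℂ` (`h₁ w = h₀ w⁻¹` for `w ≠ 0`), continuous, each of whose zeros is INTERIOR or
  ISOLATED (the local dichotomy supplied by the similarity principle, or by unique continuation), has
  a zero set in the first chart which is ALL of `ℂ` or FINITE.  The argument is that of
  `Literature.Geometry.Symplectic.twoChart_preimage_eq_univ_or_finite` (Wendl 2018, Thm. 2.49, first
  assertion): the interior of the closed zero set is closed, hence `∅` or `ℂ`; in the first case the
  zero set is discrete and, by the same dichotomy for `h₁` at `w = 0`, bounded, hence finite.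
* `TwoChartZeroSet.injective_mfderiv_snd` — the second chart `v₀` of a two-chart curve
  (`v₀ z = u₀ z⁻¹`) is immersed at every `w ≠ 0` where `u₀` is immersed at `w⁻¹` (chain rule through
  the inversion, whose real differential at `w ≠ 0` is invertible).

References: C. Wendl, *Holomorphic Curves in Low Dimensions*, LNM 2216 (2018), Thm. 2.49.  No new
definitions, notation or instances.
-/

noncomputable section

open scoped Manifold ContDiff Topology
open Set Function Filter Metric

-- the prescribed namespace `Summit.<P>.<Sub>.…` duplicates `SmoothPoincare4` (P = Sub)
set_option linter.dupNamespace false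

namespace Summit.SmoothPoincare4.SmoothPoincare4.Theorems.GromovRecognitionRelEnd.CrossCapLaurent

namespace TwoChartZeroSet

/-- **The second chart of a two-chart curve is immersed off the origin**: if `v₀ z = u₀ z⁻¹` for
`z ≠ 0`, `u₀` is `C^∞` and `du₀(w⁻¹)` is injective, then `dv₀(w)` is injective (`w ≠ 0`).
[folklore] -/
theorem injective_mfderiv_snd {X : Type*} [TopologicalSpace X]
    [ChartedSpace (EuclideanSpace ℝ (Fin 4)) X] [IsManifold (𝓡 4) ∞ X] {u₀ v₀ : ℂ → X}
    (hu₀ : ContMDiff 𝓘(ℝ, ℂ) (𝓡 4) ∞ u₀) (huv : ∀ z : ℂ, z ≠ 0 → v₀ z = u₀ z⁻¹) {w : ℂ}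
    (hw : w ≠ 0) (hinj : Injective (mfderiv 𝓘(ℝ, ℂ) (𝓡 4) u₀ w⁻¹)) :
    Injective (mfderiv 𝓘(ℝ, ℂ) (𝓡 4) v₀ w) := by
  -- `v₀ = u₀ ∘ inv` near `w`
  have hev : v₀ =ᶠ[𝓝 w] (u₀ ∘ fun z : ℂ => z⁻¹) := by
    filter_upwards [isOpen_compl_singleton.mem_nhds hw] with z hz
    exact huv z hz
  -- the differential of the inversion at `w`
  set L : ℂ →L[ℝ] ℂ := ((ContinuousLinearMap.smulRight (1 : ℂ →L[ℂ] ℂ) (-(w ^ 2)⁻¹)).restrictScalars ℝ)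
    with hL
  have hinv : HasMFDerivAt 𝓘(ℝ, ℂ) 𝓘(ℝ, ℂ) (fun z : ℂ => z⁻¹) w L :=
    (Literature.Geometry.Symplectic.hasFDerivAt_inv_restrictScalars hw).hasMFDerivAt
  have hu : HasMFDerivAt 𝓘(ℝ, ℂ) (𝓡 4) u₀ ((fun z : ℂ => z⁻¹) w)
      (mfderiv 𝓘(ℝ, ℂ) (𝓡 4) u₀ w⁻¹) :=
    ((hu₀ _).mdifferentiableAt (by simp)).hasMFDerivAt
  have hcomp := (hu.comp w hinv).congr_of_eventuallyEq hev
  rw [hcomp.mfderiv]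
  intro a b hab
  have h1 : (show ℂ from L a) = (show ℂ from L b) := hinj hab
  have hLapply : ∀ x : ℂ, (show ℂ from L x) = x * (-(w ^ 2)⁻¹) := fun x => by simp [hL]
  rw [hLapply, hLapply] at h1
  have hne : (-(w ^ 2)⁻¹ : ℂ) ≠ 0 := neg_ne_zero.2 (inv_ne_zero (pow_ne_zero 2 hw))
  have h2 : (show ℂ from a) = (show ℂ from b) := mul_right_cancel₀ hne h1
  exact h2

/-- A subset of `ℂ` containing a ball is infinite (it contains an injective image of a real
interval). [folklore] -/
theorem infinite_of_ball_subset {S : Set ℂ} {z₀ : ℂ} {r : ℝ} (hr : 0 < r) (h : ball z₀ r ⊆ S) :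
    S.Infinite := by
  have hinj : InjOn (fun t : ℝ => z₀ + (t : ℂ)) (Ioo 0 r) := fun a _ b _ hab => by
    simpa using hab
  have himg : (fun t : ℝ => z₀ + (t : ℂ)) '' Ioo 0 r ⊆ S := by
    rintro _ ⟨t, ht, rfl⟩
    apply h
    rw [mem_ball, dist_eq_norm, add_sub_cancel_left, Complex.norm_real, Real.norm_eq_abs,
      abs_of_pos ht.1]
    exact ht.2
  exact ((Set.Ioo_infinite hr).image hinj).mono himg

end TwoChartZeroSet

open TwoChartZeroSet in
/-- **Registered helper `helper_twoChartZeroSetUnivOrFinite`: the zero set of a continuous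
two-chart function with only interior-or-isolated zeros is all of `ℂ` or finite** (the argument of
`twoChart_preimage_eq_univ_or_finite`, Wendl 2018 Thm. 2.49). [cite: Wendl2018, Thm. 2.49] -/
theorem helper_twoChartZeroSetUnivOrFinite : ∀ (h₀ h₁ : ℂ → ℂ), Continuous h₀ → Continuous h₁ → (∀ w : ℂ, w ≠ 0 → h₁ w = h₀ w⁻¹) → (∀ z₀ : ℂ, h₀ z₀ = 0 → (∀ᶠ z in 𝓝 z₀, h₀ z = 0) ∨ (∀ᶠ z in 𝓝[≠] z₀, h₀ z ≠ 0)) → (h₁ 0 = 0 → (∀ᶠ w in 𝓝 (0 : ℂ), h₁ w = 0) ∨ (∀ᶠ w in 𝓝[≠] (0 : ℂ), h₁ w ≠ 0)) → {z : ℂ | h₀ z = 0} = Set.univ ∨ {z : ℂ | h₀ z = 0}.Finite := by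
  intro h₀ h₁ hh₀ hh₁ hrel key key₁
  set S : Set ℂ := {z : ℂ | h₀ z = 0} with hS
  have hSc : IsClosed S := isClosed_eq hh₀ continuous_const
  -- the interior of `S` is closed
  have hclosed : IsClosed (interior S) := by
    refine isClosed_of_closure_subset fun z₁ hz₁ => ?_
    have hz₁S : z₁ ∈ S := closure_minimal interior_subset hSc hz₁
    rcases key z₁ hz₁S with h | h
    · exact mem_interior_iff_mem_nhds.2 h
    · rw [eventually_nhdsWithin_iff] at h
      obtain ⟨z₂, hz₂, hz₂'⟩ := mem_closure_iff_nhds.1 hz₁ _ h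
      by_cases hne : z₂ = z₁
      · exact hne ▸ hz₂'
      · have hz₂S : z₂ ∈ S := interior_subset hz₂'
        exact absurd hz₂S (hz₂ hne)
  rcases isClopen_iff.1 ⟨hclosed, isOpen_interior⟩ with h0 | h1
  · -- every zero is isolated; bounded via `h₁` at `0`; hence finite
    right
    have hiso : ∀ z₀ ∈ S, ∀ᶠ z in 𝓝[≠] z₀, z ∉ S := fun z₀ hz₀ =>
      (key z₀ hz₀).resolve_left fun h => by
        have hmem : z₀ ∈ interior S := mem_interior_iff_mem_nhds.2 h
        rw [h0] at hmem
        exact hmem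
    have hbd : ∀ᶠ w in 𝓝[≠] (0 : ℂ), h₁ w ≠ 0 := by
      by_cases h10 : h₁ 0 = 0
      · rcases key₁ h10 with h | h
        · exfalso
          obtain ⟨δ, hδ, hball⟩ := Metric.eventually_nhds_iff_ball.1 h
          have hsub : {z : ℂ | δ⁻¹ < ‖z‖} ⊆ S := fun z hz => by
            have hzpos : 0 < ‖z‖ := lt_trans (inv_pos.2 hδ) hz
            have hz0 : z ≠ 0 := norm_pos_iff.1 hzpos
            have hmem : h₁ z⁻¹ = 0 := hball _ (by
              rw [mem_ball, dist_zero_right, norm_inv]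
              exact inv_lt_of_inv_lt₀ hδ hz)
            show h₀ z = 0
            rwa [hrel _ (inv_ne_zero hz0), inv_inv] at hmem
          have hopen : IsOpen {z : ℂ | δ⁻¹ < ‖z‖} := isOpen_lt continuous_const continuous_norm
          have hpt : ((2 * δ⁻¹ : ℝ) : ℂ) ∈ interior S := by
            refine interior_maximal hsub hopen ?_
            show δ⁻¹ < ‖((2 * δ⁻¹ : ℝ) : ℂ)‖
            rw [Complex.norm_real, Real.norm_eq_abs, abs_of_pos (by positivity)]
            linarith [inv_pos.2 hδ]
          rw [h0] at hpt
          exact hpt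
        · exact h
      · exact eventually_nhdsWithin_of_eventually_nhds
          ((hh₁.tendsto 0).eventually (isOpen_compl_singleton.mem_nhds h10))
    rw [eventually_nhdsWithin_iff, Metric.eventually_nhds_iff_ball] at hbd
    obtain ⟨δ, hδ, hδball⟩ := hbd
    have hSbdd : S ⊆ closedBall 0 δ⁻¹ := fun z hz => by
      by_contra hfar
      rw [mem_closedBall, dist_zero_right, not_le] at hfar
      have hzpos : 0 < ‖z‖ := lt_trans (inv_pos.2 hδ) hfar
      have hz0 : z ≠ 0 := norm_pos_iff.1 hzpos
      have h1 : z⁻¹ ∈ ball (0 : ℂ) δ := by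
        rw [mem_ball, dist_zero_right, norm_inv]
        exact inv_lt_of_inv_lt₀ hδ hfar
      have h2 := hδball _ h1 (by simpa using hz0)
      rw [hrel _ (inv_ne_zero hz0), inv_inv] at h2
      exact h2 hz
    have hScpt : IsCompact S := (isCompact_closedBall 0 δ⁻¹).of_isClosed_subset hSc hSbdd
    set U : ℂ → Set ℂ := fun z => {y : ℂ | y ∈ ({z}ᶜ : Set ℂ) → y ∉ S} with hU
    have hUn : ∀ z ∈ S, U z ∈ 𝓝 z := fun z hz => by
      have h := hiso z hz
      rw [eventually_nhdsWithin_iff] at h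
      exact h
    obtain ⟨t, -, hcover⟩ := hScpt.elim_nhds_subcover U hUn
    refine t.finite_toSet.subset fun z hz => ?_
    obtain ⟨x, hxt, hzU⟩ := mem_iUnion₂.1 (hcover hz)
    by_cases hzx : z = x
    · rw [hzx]
      exact hxt
    · exact absurd hz (hzU hzx)
  · left
    exact eq_univ_of_univ_subset (h1 ▸ interior_subset)

end Summit.SmoothPoincare4.SmoothPoincare4.Theorems.GromovRecognitionRelEnd.CrossCapLaurent

end
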